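import Literature.AlgebraicGeometry.Frobenioids.Thm42SubII
import Literature.AlgebraicGeometry.Frobenioids.PrimesEquivBaseIso
import Literature.AlgebraicGeometry.Frobenioids.BiratUnitsPullback
import Literature.AlgebraicGeometry.Frobenioids.DivIdentityPrimeRays
import HarnessLib

/-!
# [FrdI] Theorem 4.2 (i): `Ψ` preserves Div-identity endomorphisms (S5 row T42-L11, slot `FrdI.T42.PreservesDivIdentity`)

Mochizuki, *The geometry of Frobenioids I: the general theory*, Kyushu J. Math. **62** (2008)
293–400, §4, Theorem 4.2 (i), proof p. 81 ll. 5–31 (render `paper:url-bbf705efa10f`, read on the page)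
[cite: MochizukiFrdI2008, Thm. 4.2 (i) p.81]:

> "Next, we observe that `Ψ` preserves Div-identity endomorphisms. Indeed, since the `Φ_i` are
> non-dilating, it follows that if `A ∈ Ob(C_i)` [where `i = 1, 2`], then `α ∈ End_{C_i}(A)` is a
> Div-identity endomorphism if and only if `α` admits a factorization `α = β ∘ γ`, where `β : B → A`
> is a pull-back morphism, and `γ : A → B` is a base-isomorphism, such that for every primary step
> `A′ → A`, there exists a commutative diagram [`A′ → A` / `γ′`, `γ` / `B′ → B` / `β′`, `β` / `A″ → A`]
> in which the horizontal morphisms are primary steps; … the equivalence classes of the primary steps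
> `A′ → A`, `B′ → B` correspond via the bijection `Prime(Φ_i(γ))` … [cf. the functoriality of
> `Ψ^Prime(−)`]; `β′` is a pull-back morphism [cf. Proposition 1.11, (v)]; the primary steps `A′ → A`,
> `A″ → A` determine the same element of `Prime(Φ_i(A))`. This completes the proof of assertion (i)."

PROOF-ONLY file (sub-DAG `plan/L1/SUBDAG-FrdI-Thm42-Thm49.md`, row `FrdI:Thm4.2(i)/T42-L11`; statements
file `Thm42SubII.lean`, seat abc-iut-L1-t14). The printed argument, assembled in the kernel in its
DIVISOR-LEVEL form (seat abc-iut-w4-d068; parts: (a) the non-dilation half `DivIdentityPrimeRays.lean`;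
(c) the functoriality of `Ψ^Prime` on `C^{bs-iso}` = rows L09/L10, `PrimesEquivBaseIso.lean`, seats
abc-iut-L1-t2/abc-iut-w4-d090; (b)+(d) here):
* (b) the LOWER SQUARE of the diagram — for a pull-back morphism `δ : B → A` and a co-angular pre-step
  `ε″ : A″ → A`, Prop. 1.11 (v) (`exists_preStep_pullback_square`, seat abc-iut-L6-t8 lineage) gives
  `ε_B ≫ δ = δ′ ≫ ε″` with `ε_B` a co-angular pre-step into `B` and `δ′` a pull-back morphism, and the
  divisor calculus of Remark 1.1.1 (pull-backs are isometric and linear, Def. 1.3 (iv)(b)) gives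
  `x_{ε_B} = Φ(Base δ)(x_{ε″})` (`PreFrobenioid.invDiv_eq_pull_of_pullback_square`);
* (d) assembly — for a Div-identity `α = γ ≫ δ` (`γ` = Frobenius-type `≫` pre-step a base-isomorphism,
  `δ` a pull-back morphism: Def. 1.3 (iv)(a)), `Φ(Base γ)(x_{ε_B}) = Φ(Base α)(x_{ε″}) = x_{ε″}`, so `ε_B`
  is PRIMARY and its prime corresponds to that of `ε″` under `Prime(Φ(γ))`; transporting the square by
  `Ψ` (Thm. 3.4 (iii): pull-backs, Frobenius type, pre-steps; Thm. 4.2 (i): primary steps — the fields of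
  `T42.Setting` and rows L04–L07) and redoing the divisor calculus in `C₂` gives
  `x_{Ψε_B} = Φ₂(Base Ψδ)(x_{Ψε″})`; the functoriality of `Ψ^Prime` along the base-isomorphism `γ`
  (`primesEquiv_naturality_baseIso_mem`) then places `Φ₂(Base Ψα)(x_{Ψε″})` `≼`-below an element of the
  prime of `x_{Ψε″}`; since every prime of `Φ₂((ΨA)_D)` is reached this way (`Ψ^Prime` is a bijection,
  row L08 `existsUnique_primesEquiv`), the non-dilation half (a) (`Φ₂` non-dilating) yields that `Ψ α` is
  a Div-identity endomorphism (`FrdI.T42.isDivIdentity_map`), and the slot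
  `FrdI.T42.PreservesDivIdentity` closes (`preservesDivIdentity_holds`).
Composition is diagrammatic; monoids multiplicative. No new definitions; nothing of the paper is asserted
beyond what is proved.
-/

namespace Literature.AlgebraicGeometry.Frobenioids

open CategoryTheory Opposite

/-! ## (b) The lower square: pulling a co-angular pre-step back along a pull-back morphism -/

namespace PreFrobenioid

universe w v v' u u' w₂ v₂ v₂' u₂ u₂'

variable {D : Type u} [Category.{v} D] {Φ : Dᵒᵖ ⥤ CommMonCat.{w}}
  {C : Type u'} [Category.{v'} C] {F : C ⥤ ElemFrobenioid Φ}

/-- **Divisor calculus of the Prop. 1.11 (v) square** (Remark 1.1.1 + Def. 1.3 (iv)(b): pull-back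
morphisms are isometric and linear): in a commutative square `ε_B ≫ δ = δ′ ≫ ε″` of a Frobenioid with
`δ`, `δ′` pull-back morphisms and `ε″`, `ε_B` pre-steps, `x_{ε_B} = Φ(Base δ)(x_{ε″})`.
[cite: MochizukiFrdI2008, Prop. 1.11 (v) p.37] -/
theorem invDiv_eq_pull_of_pullback_square (hF : IsFrobenioid F) {W B A'' A : C} {εB : W ⟶ B}
    {δ : B ⟶ A} {δ' : W ⟶ A''} {ε'' : A'' ⟶ A} (hεB : IsPreStep F εB) (hδ : IsPullbackMorphism F δ)
    (hδ' : IsPullbackMorphism F δ') (hε'' : IsPreStep F ε'') (hsq : εB ≫ δ = δ' ≫ ε'') :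
    invDiv F εB hεB.2 = pull Φ (Base F δ) (invDiv F ε'' hε''.2) := by
  refine invDiv_eq_pull_of_square (F := F) hε''.2 hεB.2 fun y hy => ?_
  -- `Div(ε_B ≫ δ) = Div(ε_B)` and `Div(δ′ ≫ ε″) = Base(δ′)^* Div(ε″)`
  have h1 : Div F (εB ≫ δ) = Div F εB := by
    rw [div_comp, show Div F δ = 1 from (hF.iv_b δ hδ).1.2, map_one, one_mul,
      show degFr F δ = 1 from (hF.iv_b δ hδ).2, PNat.one_coe, pow_one]
  have h2 : Div F (δ' ≫ ε'') = pull Φ (Base F δ') (Div F ε'') := by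
    rw [div_comp, show Div F δ' = 1 from (hF.iv_b δ' hδ').1.2, one_pow, mul_one]
  rw [hsq, base_comp, pull_comp, hy, ← h2, ← hsq, h1]

/-- **Non-dilation, existential form**: if for every prime `𝔭 ⊆ Φ(A_D)` SOME element `p ∈ 𝔭` satisfies
`Base(α)^*(p) ≼ p`, then `α` is a Div-identity endomorphism (`Φ` non-dilating) — all elements of `𝔭`
being `≼`-equivalent. [cite: MochizukiFrdI2008, Thm. 4.2 (i) p.81] -/
theorem isDivIdentity_of_exists_precsim (hP : IsPreFrobenioid Φ F) (hnd : IsNonDilatingOn Φ) {A : C}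
    (α : A ⟶ A)
    (h : ∀ 𝔭 : Primes (Φ.obj (op (baseObj F A))), ∃ p ∈ 𝔭.carrier, pull Φ (Base F α) p ≼ p) :
    IsDivIdentity F α := by
  refine isDivIdentity_of_precsim_of_isPrimary hP hnd α fun x hx => ?_
  obtain ⟨p, hp, hpp⟩ := h (Quotient.mk _ ⟨x, hx⟩)
  have hx' := mem_carrier_mk_of_isPrimary hx
  exact (((Primes.precsim_of_mem_carrier _ hx' hp).map (pull Φ (Base F α))).trans hpp).trans
    (Primes.precsim_of_mem_carrier _ hp hx')

end PreFrobenioid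

/-! ## (d) Assembly: `Ψ` preserves Div-identity endomorphisms -/

namespace FrdI.T42

universe w v v' u u'

variable {D₁ : Type u} [Category.{v} D₁] {Φ₁ : D₁ᵒᵖ ⥤ CommMonCat.{w}} {C₁ : Type u'} [Category.{v'} C₁]
  {D₂ : Type u} [Category.{v} D₂] {Φ₂ : D₂ᵒᵖ ⥤ CommMonCat.{w}} {C₂ : Type u'} [Category.{v'} C₂]
  {F₁ : C₁ ⥤ ElemFrobenioid Φ₁} {F₂ : C₂ ⥤ ElemFrobenioid Φ₂} {Ψ : C₁ ≌ C₂}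

set_option backward.isDefEq.respectTransparency false in
/-- **[FrdI] Thm. 4.2 (i), "`Ψ` preserves Div-identity endomorphisms"** (p. 81 ll. 5–31), in the setting of
the proof after its two reductions (`T42.Setting`: Frobenioids of perfect and isotropic type, `Φ_i`
perf-factorial, `Ψ` with the conclusions of Thm. 3.4 (ii)(iii)), with `Φ₂` non-dilating and `Ψ`, `Ψ⁻¹`
preserving primary pre-steps (row L07): for every endomorphism `α` of an object `A` of `C₁`, if `α` is a
Div-identity endomorphism then so is `Ψ α`. [cite: MochizukiFrdI2008, Thm. 4.2 (i) p.81] -/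
theorem isDivIdentity_map (S : Setting F₁ F₂ Ψ) (hnd₂ : IsNonDilatingOn Φ₂)
    (hprim : ∀ ⦃X Y : C₁⦄ (φ : X ⟶ Y), PreFrobenioid.IsPrimaryPreStep F₁ φ →
      PreFrobenioid.IsPrimaryPreStep F₂ (Ψ.functor.map φ))
    (hprim' : ∀ ⦃X Y : C₂⦄ (φ : X ⟶ Y), PreFrobenioid.IsPrimaryPreStep F₂ φ →
      PreFrobenioid.IsPrimaryPreStep F₁ (Ψ.inverse.map φ))
    {A : C₁} (α : A ⟶ A) (hα : PreFrobenioid.IsDivIdentity F₁ α) :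
    PreFrobenioid.IsDivIdentity F₂ (Ψ.functor.map α) := by
  open PreFrobenioid in
  classical
  have hF₁ := S.isFrobenioid₁
  have hF₂ := S.isFrobenioid₂
  have hP₂ := hF₂.isPreFrobenioid
  -- the family `e = Ψ^Prime` with its defining property (row L08, one object at a time)
  have H := fun X : C₁ => existsUnique_primesEquiv Ψ hF₁ hF₂ S.isotropic₁ S.isotropic₂
    S.perfFactorial₁ S.perfFactorial₂ S.preStep_map S.preStep_inv X (fun E ε hε => hprim ε hε)
    (fun Z ξ hξ => hprim' ξ hξ)
  choose e he using fun X => (H X).exists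
  have he' : ∀ (X : C₁) ⦃E : C₁⦄ (ε : E ⟶ X) (hε : IsPrimaryPreStep F₁ ε)
      (𝔭 : Primes (Φ₁.obj (op (baseObj F₁ X)))), invDiv F₁ ε hε.1.2 ∈ 𝔭.carrier →
        ∀ h₂ : IsBaseIso F₂ (Ψ.functor.map ε), invDiv F₂ (Ψ.functor.map ε) h₂ ∈ (e X 𝔭).carrier :=
    fun X E ε hε 𝔭 h _ => he X ε hε 𝔭 h
  -- Def. 1.3 (iv)(a): `α = γ_F ≫ β_p ≫ δ`; `γ := γ_F ≫ β_p` is a base-isomorphism, `δ` a pull-back morphism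
  obtain ⟨X, B, γF, βp, δ, hfac, hγF, hβp, hδ⟩ := hF₁.iv_a_exists α
  have hγbase : IsBaseIso F₁ (γF ≫ βp) := by
    haveI : IsIso (Base F₁ γF) := hγF.2
    haveI : IsIso (Base F₁ βp) := hβp.2
    change IsIso (Base F₁ (γF ≫ βp))
    rw [base_comp]
    infer_instance
  have hfac' : (γF ≫ βp) ≫ δ = α := by rw [Category.assoc]; exact hfac
  -- the criterion: one element per prime of `Φ₂((ΨA)_D)`
  refine isDivIdentity_of_exists_precsim hP₂ hnd₂ (Ψ.functor.map α) fun 𝔮 => ?_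
  -- `𝔮 = e_A 𝔭`; a co-angular (primary) pre-step `ε″ : A″ → A` with `x_{ε″} ∈ 𝔭`
  obtain ⟨⟨p, hp⟩, hp𝔭⟩ := Quotient.exists_rep ((e A).symm 𝔮)
  have hpmem : p ∈ ((e A).symm 𝔮).carrier := by rw [← hp𝔭]; exact mem_carrier_mk_of_isPrimary hp
  obtain ⟨A'', ε'', hε'', hε''x⟩ := hF₁.iii_d_over_surj A p
  have hε''prim : IsPrimaryPreStep F₁ ε'' :=
    isPrimaryPreStep_of_isPrimary_invDiv hε''.2 (by rw [hε''x]; exact hp)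
  have hε''mem : invDiv F₁ ε'' hε''.2.2 ∈ ((e A).symm 𝔮).carrier := by rw [hε''x]; exact hpmem
  -- (b) the lower square `ε_B ≫ δ = δ′ ≫ ε″` and its divisor calculus
  obtain ⟨W, εB, δ', hεB, hδ', hsq⟩ := exists_preStep_pullback_square hF₁ S.isotropic₁ δ hδ ε'' hε''
  have hxB : invDiv F₁ εB hεB.2.2 = pull Φ₁ (Base F₁ δ) (invDiv F₁ ε'' hε''.2.2) :=
    invDiv_eq_pull_of_pullback_square hF₁ hεB.2 hδ hδ' hε''.2 hsq
  -- `Φ(Base γ)(x_{ε_B}) = Φ(Base α)(x_{ε″}) = x_{ε″}`, so `ε_B` is primary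
  have hγxB : pull Φ₁ (Base F₁ (γF ≫ βp)) (invDiv F₁ εB hεB.2.2) = invDiv F₁ ε'' hε''.2.2 := by
    rw [hxB, ← pull_comp, ← base_comp, hfac', show pull Φ₁ (Base F₁ α) = MonoidHom.id _ from hα,
      MonoidHom.id_apply]
  have hxBprim : IsPrimary (invDiv F₁ εB hεB.2.2) := by
    haveI : IsIso (Base F₁ (γF ≫ βp)) := hγbase
    have h := isPrimary_invDiv hε''prim
    rw [← hγxB] at h
    exact (isPrimary_pull_iff (Base F₁ (γF ≫ βp)) _).mp h
  have hεBprim : IsPrimaryPreStep F₁ εB := isPrimaryPreStep_of_isPrimary_invDiv hεB.2 hxBprim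
  let 𝔭B : Primes (Φ₁.obj (op (baseObj F₁ B))) := Quotient.mk _ ⟨_, hxBprim⟩
  have hxBmem : invDiv F₁ εB hεB.2.2 ∈ 𝔭B.carrier := mem_carrier_mk_of_isPrimary hxBprim
  -- (c) functoriality of `Ψ^Prime` along the base-isomorphism `γ` (rows L09/L10)
  obtain ⟨q', hq', hq'pull⟩ := primesEquiv_naturality_baseIso_mem Ψ hF₁ hF₂ S.perfect₁ S.perfect₂
    S.isotropic₁ S.isotropic₂ S.perfFactorial₁ S.perfFactorial₂ S.preStep_map S.preStep_inv
    S.frobeniusType_map hprim e he' (γF ≫ βp) hγbase ((e A).symm 𝔮) 𝔭B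
    ⟨invDiv F₁ εB hεB.2.2, hxBmem, by rw [hγxB]; exact hε''mem⟩
  rw [Equiv.apply_symm_apply] at hq'pull
  -- (d) the square transported by `Ψ` and its divisor calculus in `C₂`
  have hΨεB : IsPreStep F₂ (Ψ.functor.map εB) := S.preStep_map εB hεB.2
  have hΨε'' : IsPreStep F₂ (Ψ.functor.map ε'') := S.preStep_map ε'' hε''.2
  have hΨsq : Ψ.functor.map εB ≫ Ψ.functor.map δ = Ψ.functor.map δ' ≫ Ψ.functor.map ε'' := by
    rw [← Functor.map_comp, hsq, Functor.map_comp]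
  have hxB₂ : invDiv F₂ (Ψ.functor.map εB) hΨεB.2 =
      pull Φ₂ (Base F₂ (Ψ.functor.map δ)) (invDiv F₂ (Ψ.functor.map ε'') hΨε''.2) :=
    invDiv_eq_pull_of_pullback_square hF₂ hΨεB (S.pullback_map δ hδ) (S.pullback_map δ' hδ') hΨε'' hΨsq
  -- memberships given by `e`
  have hq : invDiv F₂ (Ψ.functor.map ε'') hΨε''.2 ∈ 𝔮.carrier := by
    have h := he A ε'' hε''prim ((e A).symm 𝔮) hε''mem
    rwa [Equiv.apply_symm_apply] at h
  have hqB : invDiv F₂ (Ψ.functor.map εB) hΨεB.2 ∈ (e B 𝔭B).carrier := he B εB hεBprim 𝔭B hxBmem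
  -- conclusion: `Φ₂(Base Ψα)(x_{Ψε″}) = Φ₂(Base Ψγ)(x_{Ψε_B}) ≼ Φ₂(Base Ψγ)(q′) ≼ x_{Ψε″}`
  refine ⟨invDiv F₂ (Ψ.functor.map ε'') hΨε''.2, hq, ?_⟩
  have hcalc : pull Φ₂ (Base F₂ (Ψ.functor.map α)) (invDiv F₂ (Ψ.functor.map ε'') hΨε''.2) =
      pull Φ₂ (Base F₂ (Ψ.functor.map (γF ≫ βp))) (invDiv F₂ (Ψ.functor.map εB) hΨεB.2) := by
    rw [hxB₂, ← pull_comp, ← base_comp, ← Functor.map_comp, hfac']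
  rw [hcalc]
  exact (((Primes.precsim_of_mem_carrier _ hqB hq').map _).trans
    (Primes.precsim_of_mem_carrier _ hq'pull hq))

/-- **Row T42-L11, slot `FrdI.T42.PreservesDivIdentity` DISCHARGED** ([FrdI] Thm. 4.2 (i), proof p. 81
ll. 5–31: "`Ψ` preserves Div-identity endomorphisms"), by `isDivIdentity_map` (the hypotheses "`Φ₁`
non-dilating" and "`A` not group-like" of the slot are not needed and are ignored).
[cite: MochizukiFrdI2008, Thm. 4.2 (i) p.81] -/
theorem preservesDivIdentity_holds : PreservesDivIdentity := by
  intro D₁ _ Φ₁ C₁ _ D₂ _ Φ₂ C₂ _ F₁ F₂ Ψ hS _ hnd₂ hprim hprim' A _ α hα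
  exact isDivIdentity_map hS hnd₂ hprim hprim' α hα

/-- `PreservesDivIdentity` — `_holds` alias of `preservesDivIdentity_holds` above under the fact's exact name (appended
2026-08-28, D-0026 bookkeeping: the proof term is the existing theorem of this file; no statement,
definition or attribute is edited; no new named fact; the ledger's debt table listed the fact
unproved). [cite: MochizukiFrdI2008, Thm. 4.2 (i) p.81] -/
theorem _root_.Literature.AlgebraicGeometry.Frobenioids.FrdI.T42.PreservesDivIdentity_holds :
    PreservesDivIdentity :=
  _root_.Literature.AlgebraicGeometry.Frobenioids.FrdI.T42.preservesDivIdentity_holds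

end FrdI.T42

end Literature.AlgebraicGeometry.Frobenioids
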